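import Mathlib
import Summits.ResolutionOfSingularities.ResolutionOfSingularities.Theorems.RadicialJungCleanModelsCleanLU3ArcInfinite
import Summits.ResolutionOfSingularities.ResolutionOfSingularities.Theorems.RadicialJungCleanModelsStubDerivationOfNotMemAdjoinPow
import HarnessLib

/-!
# Route `RadicialJung`, crux `CleanModels` (stmt-15917), stub `stub_cleanLU3Defect`: **CLASS (A) OVER A PERFECT GROUND FIELD** —
# the arc case of clean local uniformization in dimension three, unconditionally

Line `Sketch` rev 21 of crux stmt-ResolutionOfSingularities-15917; lead `res-B-lead-1` g3.  OURS; nothing here proves resolution in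
characteristic `p`.

`cleanLU3DefectArc_of_perfectField`: over a PERFECT ground field `k`, the rev-18 statement of `stub_cleanLU3Defect` holds at every
zero-dimensional DISCRETE RANK-ONE valuation ring: the two extra hypotheses of ✓ `cleanLU3Defect_of_discrete_of_perfectResidues` are
discharged — every intermediate ring `A ⊆ T ⊆ O` has all residues `p`-th powers (`perfect_residues_of_perfectField`: the centre of `O` on the
finitely generated `A[r]` is maximal, its residue field is a finitely generated `k`-algebra and a field, hence finite over `k` (Zariski's
lemma) and perfect), and a derivation of `K` moving `g₀` and preserving `A` up to a denominator exists (✓ `stub_derivation_of_not_mem_adjoin_pow`,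
seat res-B-deriv-w1, since `k[K^p] ⊆ K^p ∌ g₀` when `k` is perfect: `exists_pow_eq_of_mem_adjoin_pow`).
-/

noncomputable section

set_option linter.dupNamespace false -- mandated namespace of this single-conjunct summit

open IsLocalRing
open Literature.AlgebraicGeometry.Resolution

namespace Summit.ResolutionOfSingularities.ResolutionOfSingularities.Theorems.RadicialJung.CleanModels

variable {k K : Type} [Field k] [Field K] [Algebra k K]

/-- Over a perfect field `k` of characteristic `p`, every element of `k[K^p]` (the `k`-subalgebra generated by the `p`-th powers) is a
`p`-th power. [folklore] -/
theorem exists_pow_eq_of_mem_adjoin_pow {p : ℕ} [hp : Fact p.Prime] [CharP k p] [PerfectField k] [CharP K p]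
    {x : K} (hx : x ∈ Algebra.adjoin k (Set.range fun y : K => y ^ p)) : ∃ c : K, c ^ p = x := by
  haveI : ExpChar k p := ExpChar.prime hp.out
  induction hx using Algebra.adjoin_induction with
  | mem y hy => obtain ⟨z, rfl⟩ := hy; exact ⟨z, rfl⟩
  | algebraMap a =>
    obtain ⟨b, hb⟩ := surjective_frobenius k p a
    refine ⟨algebraMap k K b, ?_⟩
    rw [← map_pow, ← hb, frobenius_def]
  | add y z _ _ hy hz =>
    obtain ⟨c, rfl⟩ := hy; obtain ⟨d, rfl⟩ := hz
    exact ⟨c + d, add_pow_char c d p⟩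
  | mul y z _ _ hy hz =>
    obtain ⟨c, rfl⟩ := hy; obtain ⟨d, rfl⟩ := hz
    exact ⟨c * d, mul_pow c d p⟩

/-- **Perfect ground field ⟹ perfect residues.**  If `k` is perfect and `O` is zero-dimensional above the finitely generated `A` (every
centre above `A` maximal), then every element of every intermediate ring `A ⊆ T ⊆ O` is a `p`-th power modulo the centre of `O`. [folklore] -/
theorem perfect_residues_of_perfectField {p : ℕ} [hp : Fact p.Prime] [CharP k p] [PerfectField k] (O : ValuationSubring K)
    (A : Subalgebra k K) (hAfg : A.FG)
    (hzd : ∀ (T : Subring K) (hT : T ≤ O.toSubring), A.toSubring ≤ T → (subringCentre T O hT).IsMaximal) :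
    ∀ (T : Subring K), T ≤ O.toSubring → A.toSubring ≤ T → ∀ r : K, r ∈ T → ∃ t : K, t ∈ T ∧ O.valuation (r - t ^ p) < 1 := by
  classical
  intro T hTO hAT r hr
  obtain ⟨A', hA'sub, hAA', hfg⟩ := exists_subalgebra_closure A {r}
  have hA'T : A'.toSubring ≤ T := by
    rw [hA'sub, Subring.closure_le]
    rintro w (hw | hw)
    · exact hAT hw
    · rw [Finset.coe_singleton, Set.mem_singleton_iff] at hw; rw [hw]; exact hr
  have hA'O : A'.toSubring ≤ O.toSubring := hA'T.trans hTO
  have hrA' : r ∈ A'.toSubring := by rw [hA'sub]; exact Subring.subset_closure (Or.inr (by simp))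
  haveI hmax : (subringCentre A'.toSubring O hA'O).IsMaximal := hzd A'.toSubring hA'O (fun w hw => hAA' hw)
  set 𝔮 := subringCentre A'.toSubring O hA'O with h𝔮
  letI : Field (A'.toSubring ⧸ 𝔮) := Ideal.Quotient.field 𝔮
  letI : Algebra k A'.toSubring := inferInstanceAs (Algebra k A')
  haveI : Algebra.FiniteType k A'.toSubring := (A'.fg_iff_finiteType.mp (hfg hAfg) : Algebra.FiniteType k A')
  haveI : Algebra.FiniteType k (A'.toSubring ⧸ 𝔮) :=
    Algebra.FiniteType.of_surjective (Ideal.Quotient.mkₐ k 𝔮) (Ideal.Quotient.mkₐ_surjective k 𝔮)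
  haveI : Module.Finite k (A'.toSubring ⧸ 𝔮) := finite_of_finite_type_of_isJacobsonRing k (A'.toSubring ⧸ 𝔮)
  haveI : Algebra.IsAlgebraic k (A'.toSubring ⧸ 𝔮) := Algebra.IsAlgebraic.of_finite k _
  haveI : PerfectField (A'.toSubring ⧸ 𝔮) := Algebra.IsAlgebraic.perfectField k
  haveI : CharP (A'.toSubring ⧸ 𝔮) p := charP_of_injective_algebraMap (algebraMap k (A'.toSubring ⧸ 𝔮)).injective p
  haveI : ExpChar (A'.toSubring ⧸ 𝔮) p := ExpChar.prime hp.out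
  obtain ⟨tbar, htbar⟩ := surjective_frobenius (A'.toSubring ⧸ 𝔮) p (Ideal.Quotient.mk 𝔮 ⟨r, hrA'⟩)
  obtain ⟨t, rfl⟩ := Ideal.Quotient.mk_surjective tbar
  refine ⟨(t : K), hA'T t.2, ?_⟩
  have hmem : (⟨r, hrA'⟩ : A'.toSubring) - t ^ p ∈ 𝔮 := by
    rw [← Ideal.Quotient.eq, map_pow, ← htbar, frobenius_def]
  exact (mem_subringCentre_iff hA'O _).mp hmem

/-- **Class (A) over a perfect ground field.**  See the module docstring. [folklore] -/
theorem cleanLU3DefectArc_of_perfectField :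
    ∀ (p : ℕ), p.Prime →
    ∀ (k : Type) [Field k] [CharP k p] (K : Type) [Field K] [Algebra k K]
    (O : ValuationSubring K) (A : Subalgebra k K), A.toSubring ≤ O.toSubring → A.FG → IsFractionRing A K →
    ringKrullDim A ≤ 3 → IsRegularLocalRing (locAtCentre A.toSubring O) →
    ringKrullDim (locAtCentre A.toSubring O) = 3 →
    (∀ (T : Subring K) (hT : T ≤ O.toSubring), A.toSubring ≤ T → (subringCentre T O hT).IsMaximal) →
    ∀ g₀ : K, (∀ c : K, c ^ p ≠ g₀) →
    (∀ f₀ : K, ∃ f₁ : K, O.valuation (g₀ - f₁ ^ p) < O.valuation (g₀ - f₀ ^ p)) →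
    (∀ hk : ∀ c : k, algebraMap k K c ∈ O, transcendenceDefect k O hk ≠ 0) →
    PerfectField k →
    (∃ π : K, π ≠ 0 ∧ (∀ x : K, O.valuation x < 1 → O.valuation x ≤ O.valuation π) ∧
      (∀ x : K, x ≠ 0 → ∃ n : ℕ, O.valuation π ^ n ≤ O.valuation x)) →
    ∃ (A' : Subalgebra k K), A'.toSubring ≤ O.toSubring ∧ A ≤ A' ∧ A'.FG ∧
    ∃ (_ : IsRegularLocalRing (locAtCentre A'.toSubring O)) (c : Fin p → K), (∃ j : Fin p, (j : ℕ) ≠ 0 ∧ c j ≠ 0) ∧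
    ((∃ (d m : ℕ) (hmd : m ≤ d) (t : Fin d → ↥(locAtCentre A'.toSubring O)) (a : Fin m → ℕ) (u : ↥(locAtCentre A'.toSubring O)), IsUnit u ∧
    Ideal.span (Set.range t) = IsLocalRing.maximalIdeal ↥(locAtCentre A'.toSubring O) ∧
    ringKrullDim ↥(locAtCentre A'.toSubring O) = (d : WithBot ℕ∞) ∧ 0 < m ∧ (∀ i, ¬ p ∣ a i) ∧
    (∑ j : Fin p, c j ^ p * g₀ ^ (j : ℕ)) = (u : K) * ∏ i : Fin m, ((t (Fin.castLE hmd i) : ↥(locAtCentre A'.toSubring O)) : K) ^ (a i)) ∨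
    (∃ u : ↥(locAtCentre A'.toSubring O), IsUnit u ∧ (∑ j : Fin p, c j ^ p * g₀ ^ (j : ℕ)) = (u : K) ∧
    ∀ c' : ↥(locAtCentre A'.toSubring O), u - c' ^ p ∉ IsLocalRing.maximalIdeal ↥(locAtCentre A'.toSubring O)) ∨
    (∃ s c' : ↥(locAtCentre A'.toSubring O), (∑ j : Fin p, c j ^ p * g₀ ^ (j : ℕ)) = (s : K) ∧
    s - c' ^ p ∈ IsLocalRing.maximalIdeal ↥(locAtCentre A'.toSubring O) ∧
    s - c' ^ p ∉ IsLocalRing.maximalIdeal ↥(locAtCentre A'.toSubring O) ^ 2)) := by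
  intro p hp k _ _ K _ _ O A hAO hAfg hfrac hdimA hreg hdim3 hzd g₀ hg₀ hdefect htd hperfect hdisc
  haveI : Fact p.Prime := ⟨hp⟩
  haveI : CharP K p := charP_of_injective_algebraMap (algebraMap k K).injective p
  haveI := hperfect
  have hmem : g₀ ∉ Algebra.adjoin k (Set.range fun y : K => y ^ p) := fun hmem => by
    obtain ⟨c, hc⟩ := exists_pow_eq_of_mem_adjoin_pow (k := k) hmem
    exact hg₀ c hc
  exact cleanLU3Defect_of_discrete_of_perfectResidues p hp k K O A hAO hAfg hfrac hdimA hreg hdim3 hzd g₀ hg₀ hdefect htd hdisc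
    (stub_derivation_of_not_mem_adjoin_pow p hp k K A hAfg hfrac g₀ hmem) (perfect_residues_of_perfectField O A hAfg hzd)

end Summit.ResolutionOfSingularities.ResolutionOfSingularities.Theorems.RadicialJung.CleanModels

end
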